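import Literature.IUT.HodgeTheaters.InitialThetaDataPlaces
import Summits.ABC.IUTFork.Cor312ProvenanceDH
import HarnessLib

/-!
# [IUTchI] Def. 3.1 (b)/(e) bad-place COUNTS: `|V̲^bad| = |𝕍^bad_mod| ≤ |𝕍(F)^bad| = |S|`, with equality iff no place of
# `𝕍^bad_mod` has two places of `F` above it — the numeric content of the `hplaces` side condition of branch C

S. Mochizuki, *Inter-universal Teichmüller theory I*, §3, Def. 3.1 (b) "`V^bad_mod ⊆ V_mod` is a nonempty set of
nonarchimedean valuations of `F_mod` … `V(F)^bad := V^bad_mod ×_{V_mod} V(F)`", (e) "`V̲ ⊆ V(K)` is a subset that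
induces a natural bijection `V̲ ⥲ V_mod` … `V̲^bad := V̲ ∩ V(K)^bad`" (kurims final manuscript pp. 61–62); T. Dupuy,
A. Hilado, *The statement of Mochizuki's Corollary 3.12*, §3.3 "`S` the places of bad multiplicative reduction".

PROOF-ONLY record file (D-0012; no `def`, no `Prop` fact, no instance) of the abc-iut cell (block C / W6 cone prover
abc-iut-w6-d105; the «hplaces-COUNT» piece of abc-iut-w4-d020's `hplaces` row of abc-iut-C-cert-2's «ABC_OF_S HYPS (7)»).
TAKES NO SIDE on [IUTchIII] Cor. 3.12: everything below is elementary bookkeeping about the INDEX SETS of abc-iut-L5-t2's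
REAL definition `InitialThetaData` and abc-iut-c312-3's Dupuy–Hilado `PilotData`, proved in the kernel.

CONTEXT. The branch-C certificate at the genuine setting (`Conditional/AbcOfSGenuine.lean`, `abc_of_S_v3/v4`) carries
the READ binder `hplaces : ∃ e : (thetaIndex X).V ≃ D.V, ∀ v, v ∈ (thetaIndex X).Vbad ↔ ((e v : D.V) : Val K) ∈ D.Vbad`
(abc-iut-c312-7 `isSettingOf_settingPrVolSharp`): an index bijection between the Dupuy–Hilado place index of the pilot
datum `X` of `F` (bad part `= S = 𝕍(F)^bad`) and the section `V̲ ≃ V_mod` of [IUTchI] Def. 3.1 (e) (bad part `V̲^bad ≃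
𝕍^bad_mod`). abc-iut-w4-d020 (`Cor312PlacesIndexBijection.lean`) produces such an `e` from the single numeric condition
`|S| = |V̲^bad|`. THIS FILE computes that condition on `D` alone:

* `InitialThetaData.ncard_Vbad_eq_ncard_VbadMod` — `|V̲^bad| = |𝕍^bad_mod|` (the section restricted to the bad part,
  abc-iut-L5-t2's `vOverEquiv`);
* `InitialThetaData.finBelow_image_VFbad` — the place-below map sends `𝕍(F)^bad` ONTO `𝕍^bad_mod`
  (`Val.restrict_surjective`), whence `ncard_VbadMod_le_ncard_VFbad : |𝕍^bad_mod| ≤ |𝕍(F)^bad|`;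
* `InitialThetaData.ncard_VFbad_eq_ncard_Vbad_iff_injOn` — **`|𝕍(F)^bad| = |V̲^bad|` iff `finBelow` is injective on
  `𝕍(F)^bad`**, i.e. iff every `v ∈ 𝕍^bad_mod` has EXACTLY ONE place of `F` above it (`…_iff_existsUnique`): no bad
  place of `F_mod` splits (or has two primes above it) in `F`;
* under abc-iut-c312-8's provenance link `Cor312Prov.IsPilotDataOf D X` (`S = 𝕍(F)^bad` through
  `FinitePlace.maximalIdeal`): `Cor312Prov.IsPilotDataOf.card_S_eq_ncard_VFbad : X.S.card = |𝕍(F)^bad|` and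
  **`Cor312Prov.IsPilotDataOf.card_S_eq_ncard_Vbad_iff : X.S.card = |V̲^bad| ↔ Set.InjOn finBelow 𝕍(F)^bad`** —
  abc-iut-w4-d020's hypothesis `h : (X.S).card = D.Vbad.ncard` re-read on `D` alone, both directions.

HONEST FRAMING: counts of OUR typed index sets; the condition is NOT always satisfied (a bad place of `F_mod` may split in
the Galois extension `F/F_mod`), which is exactly why `hplaces` is a genuine side condition of the certificate and not a
theorem. Nothing here asserts or denies [IUTchIII] Cor. 3.12 or abc; typed ≠ proved; no side taken on any author.
-/

noncomputable section

open NumberField IsDedekindDomain Set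

namespace Literature.IUT.HodgeTheaters.InitialThetaData

universe u v w

variable {F : Type u} {K : Type v} {Fbar : Type w} [Field F] [NumberField F] [Field K] [NumberField K]
  [Algebra F K] [Field Fbar] [Algebra F Fbar] [Algebra K Fbar] {E : WeierstrassCurve F} [E.IsElliptic]
  {l : ℕ} {P : BadPlacePredicates K} (D : InitialThetaData F K Fbar E l P)

omit [NumberField K] [Algebra F K] [Algebra F Fbar] [Algebra K Fbar] [E.IsElliptic] in
/-- `Val.non : V(L)^non ↪ V(L)` is injective (it is the right injection of the sum `V(L) = V(L)^arc ⊔ V(L)^non`,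
[IUTchI] §0 p. 35). [folklore] -/
theorem val_non_injective (L : Type u) [Field L] [NumberField L] :
    Function.Injective (Val.non (F := L)) :=
  fun _ _ h => Sum.inr_injective h

/-- **`|V̲^bad| = |𝕍^bad_mod|`**: the section `V̲ ⥲ V_mod` of [IUTchI] Def. 3.1 (e) restricts to a bijection
`V̲^bad ⥲ 𝕍^bad_mod` (abc-iut-L5-t2's `vOverEquiv`), and `Val.non` is injective. PROVED (classical bookkeeping).
[cite: Mochizuki2012, IUTchI Def. 3.1 (e) p. 62] [claim: Mochizuki2012, status: disputed] -/
theorem ncard_Vbad_eq_ncard_VbadMod : D.Vbad.ncard = D.VbadMod.ncard := by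
  rw [Vbad_eq_VOver, ← Nat.card_coe_set_eq, Nat.card_congr (D.vOverEquiv _), Nat.card_coe_set_eq]
  exact Set.ncard_image_of_injective _ (val_non_injective (fieldOfModuli E : Type u))

omit [NumberField K] [Algebra F K] [Algebra F Fbar] [Algebra K Fbar] in
/-- Restriction of the nonarchimedean valuation of a place `x` of `F` to `F_mod` is the valuation of the place
`finBelow x` below it (definitional). [folklore] -/
theorem restrict_non_eq_non_finBelow (x : FinitePlace F) :
    Val.restrict (fieldOfModuli E) (Val.non x) = Val.non (finBelow (E := E) x) := rfl

/-- `x ∈ 𝕍(F)^bad` iff the place of `F_mod` below `x` lies in `𝕍^bad_mod` ([IUTchI] Def. 3.1 (b):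
"`V(F)^bad := V^bad_mod ×_{V_mod} V(F)`"). [cite: Mochizuki2012, IUTchI Def. 3.1 (b) p. 61]
[claim: Mochizuki2012, status: disputed] -/
theorem mem_VFbad_iff_finBelow_mem (x : FinitePlace F) : x ∈ D.VFbad ↔ finBelow (E := E) x ∈ D.VbadMod := by
  show Val.restrict (fieldOfModuli E) (Val.non x) ∈ Val.non '' D.VbadMod ↔ _
  rw [restrict_non_eq_non_finBelow]
  exact (val_non_injective (fieldOfModuli E : Type u)).mem_set_image

/-- **The place-below map sends `𝕍(F)^bad` ONTO `𝕍^bad_mod`**: every `v ∈ 𝕍^bad_mod` lies below some place of `F`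
("the natural surjection `V(K) ↠ V_mod`", [IUTchI] Def. 3.1 (e); abc-iut-L5-t2's `Val.restrict_surjective`), which is
then in `𝕍(F)^bad` by definition. PROVED. [cite: Mochizuki2012, IUTchI Def. 3.1 (b)/(e) p. 61–62]
[claim: Mochizuki2012, status: disputed] -/
theorem finBelow_image_VFbad : finBelow (E := E) '' D.VFbad = D.VbadMod := by
  ext u
  constructor
  · rintro ⟨x, hx, rfl⟩
    exact (D.mem_VFbad_iff_finBelow_mem x).mp hx
  · intro hu
    obtain ⟨x, hx⟩ := Val.restrict_surjective (fieldOfModuli E) (M := F) (Val.non u)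
    rcases x with y | x
    · exact absurd hx Sum.inl_ne_inr
    · have hxu : finBelow (E := E) x = u := Sum.inr_injective hx
      exact ⟨x, (D.mem_VFbad_iff_finBelow_mem x).mpr (hxu ▸ hu), hxu⟩

/-- **`|𝕍^bad_mod| ≤ |𝕍(F)^bad|`** (`𝕍(F)^bad` is finite, abc-iut-L5-t2's `VFbad_finite`, and maps onto `𝕍^bad_mod`).
PROVED. [cite: Mochizuki2012, IUTchI Def. 3.1 (b) p. 61] [claim: Mochizuki2012, status: disputed] -/
theorem ncard_VbadMod_le_ncard_VFbad : D.VbadMod.ncard ≤ D.VFbad.ncard := by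
  rw [← D.finBelow_image_VFbad]
  exact Set.ncard_image_le D.VFbad_finite

/-- **`|𝕍^bad_mod| = |𝕍(F)^bad|` iff the place-below map is injective on `𝕍(F)^bad`** (images of finite sets:
`Set.ncard_image_iff`). PROVED. [cite: Mochizuki2012, IUTchI Def. 3.1 (b) p. 61] [claim: Mochizuki2012, status: disputed] -/
theorem ncard_VbadMod_eq_ncard_VFbad_iff_injOn :
    D.VbadMod.ncard = D.VFbad.ncard ↔ Set.InjOn (finBelow (E := E)) D.VFbad := by
  rw [← D.finBelow_image_VFbad]
  exact Set.ncard_image_iff D.VFbad_finite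

/-- **`|𝕍(F)^bad| = |V̲^bad|` iff the place-below map is injective on `𝕍(F)^bad`** — i.e. iff no place of `𝕍^bad_mod`
has two distinct places of `F` above it. This is the numeric side condition behind the branch-C binder `hplaces`.
PROVED. [cite: Mochizuki2012, IUTchI Def. 3.1 (b)/(e) p. 61–62] [claim: Mochizuki2012, status: disputed] -/
theorem ncard_VFbad_eq_ncard_Vbad_iff_injOn :
    D.VFbad.ncard = D.Vbad.ncard ↔ Set.InjOn (finBelow (E := E)) D.VFbad := by
  rw [D.ncard_Vbad_eq_ncard_VbadMod, eq_comm]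
  exact D.ncard_VbadMod_eq_ncard_VFbad_iff_injOn

/-- Injectivity of the place-below map on `𝕍(F)^bad` is the printed-style condition «every `v ∈ 𝕍^bad_mod` has EXACTLY
ONE place of `F` above it» (existence being automatic, `finBelow_image_VFbad`). PROVED.
[cite: Mochizuki2012, IUTchI Def. 3.1 (b)/(e) p. 61–62] [claim: Mochizuki2012, status: disputed] -/
theorem injOn_finBelow_VFbad_iff_existsUnique :
    Set.InjOn (finBelow (E := E)) D.VFbad ↔
      ∀ u ∈ D.VbadMod, ∃! x : FinitePlace F, finBelow (E := E) x = u := by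
  constructor
  · intro hinj u hu
    obtain ⟨x, hx, hxu⟩ : u ∈ finBelow (E := E) '' D.VFbad := by rw [D.finBelow_image_VFbad]; exact hu
    refine ⟨x, hxu, fun y hy => hinj ?_ hx (hy.trans hxu.symm)⟩
    exact (D.mem_VFbad_iff_finBelow_mem y).mpr (hy ▸ hu)
  · intro h x hx y hy hxy
    have hu : finBelow (E := E) x ∈ D.VbadMod := (D.mem_VFbad_iff_finBelow_mem x).mp hx
    obtain ⟨z, -, hz⟩ := h _ hu
    exact (hz x rfl).trans (hz y hxy.symm).symm

/-- **`|𝕍(F)^bad| = |V̲^bad|` iff every `v ∈ 𝕍^bad_mod` has exactly one place of `F` above it.** PROVED.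
[cite: Mochizuki2012, IUTchI Def. 3.1 (b)/(e) p. 61–62] [claim: Mochizuki2012, status: disputed] -/
theorem ncard_VFbad_eq_ncard_Vbad_iff_existsUnique :
    D.VFbad.ncard = D.Vbad.ncard ↔ ∀ u ∈ D.VbadMod, ∃! x : FinitePlace F, finBelow (E := E) x = u :=
  D.ncard_VFbad_eq_ncard_Vbad_iff_injOn.trans D.injOn_finBelow_VFbad_iff_existsUnique

/-- In particular `|V̲^bad| ≤ |𝕍(F)^bad|` always. PROVED. [cite: Mochizuki2012, IUTchI Def. 3.1 (b)/(e) p. 61–62]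
[claim: Mochizuki2012, status: disputed] -/
theorem ncard_Vbad_le_ncard_VFbad : D.Vbad.ncard ≤ D.VFbad.ncard := by
  rw [D.ncard_Vbad_eq_ncard_VbadMod]
  exact D.ncard_VbadMod_le_ncard_VFbad

end Literature.IUT.HodgeTheaters.InitialThetaData

namespace Summit.ABC.IUTFork.Cor312Prov.IsPilotDataOf

open Literature.IUT.HodgeTheaters Literature.IUT.LogVolume

universe u v w

variable {F : Type u} {K : Type v} {Fbar : Type w} [Field F] [NumberField F] [Field K] [NumberField K]
  [Algebra F K] [Field Fbar] [Algebra F Fbar] [Algebra K Fbar] {E : WeierstrassCurve F} [E.IsElliptic]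
  {l : ℕ} {Pb : BadPlacePredicates K} {D : InitialThetaData F K Fbar E l Pb} {X : PilotData F}

/-- Under the provenance link, `S` is the image of `𝕍(F)^bad` under Mathlib's bijection "finite place ↦ maximal
ideal" (abc-iut-c312-8's field `mem_S_iff`). PROVED. [cite: DupuyHilado2025, §3.3] -/
theorem maximalIdeal_image_VFbad (hX : IsPilotDataOf D X) :
    (fun v : FinitePlace F => v.maximalIdeal) '' D.VFbad = (X.S : Set (HeightOneSpectrum (𝓞 F))) := by
  ext P
  constructor
  · rintro ⟨v, hv, rfl⟩
    exact (hX.mem_S_iff v).mpr hv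
  · intro hP
    refine ⟨FinitePlace.mk P, ?_, FinitePlace.maximalIdeal_mk P⟩
    exact (hX.mem_S_iff _).mp (by rw [FinitePlace.maximalIdeal_mk]; exact hP)

/-- **`|S| = |𝕍(F)^bad|`** under the provenance link `IsPilotDataOf D X` (Dupuy–Hilado's `S` IS [IUTchI]'s `𝕍(F)^bad`,
counted through the bijection `FinitePlace F ≃ HeightOneSpectrum (𝓞 F)`). PROVED.
[cite: DupuyHilado2025, §3.3] [cite: Mochizuki2012, IUTchI Def. 3.1 (b) p. 61] [claim: Mochizuki2012, status: disputed] -/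
theorem card_S_eq_ncard_VFbad (hX : IsPilotDataOf D X) : X.S.card = D.VFbad.ncard := by
  rw [← Set.ncard_coe_finset, ← hX.maximalIdeal_image_VFbad,
    Set.ncard_image_of_injective _ FinitePlace.maximalIdeal_injective]

/-- **`|S| = |V̲^bad|` iff the place-below map is injective on `𝕍(F)^bad`** — abc-iut-w4-d020's hypothesis
`h : (X.S).card = D.Vbad.ncard` of the `hplaces` index bijection, re-read on the initial Θ-data alone: it holds
exactly when no place of `𝕍^bad_mod` has two places of `F` above it. PROVED.
[cite: Mochizuki2012, IUTchI Def. 3.1 (b)/(e) p. 61–62] [cite: DupuyHilado2025, §3.3] [claim: Mochizuki2012, status: disputed] -/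
theorem card_S_eq_ncard_Vbad_iff_injOn (hX : IsPilotDataOf D X) :
    X.S.card = D.Vbad.ncard ↔ Set.InjOn (InitialThetaData.finBelow (E := E)) D.VFbad := by
  rw [hX.card_S_eq_ncard_VFbad]
  exact D.ncard_VFbad_eq_ncard_Vbad_iff_injOn

/-- **`|S| = |V̲^bad|` iff every `v ∈ 𝕍^bad_mod` has exactly one place of `F` above it.** PROVED.
[cite: Mochizuki2012, IUTchI Def. 3.1 (b)/(e) p. 61–62] [cite: DupuyHilado2025, §3.3] [claim: Mochizuki2012, status: disputed] -/
theorem card_S_eq_ncard_Vbad_iff_existsUnique (hX : IsPilotDataOf D X) :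
    X.S.card = D.Vbad.ncard ↔
      ∀ u ∈ D.VbadMod, ∃! x : FinitePlace F, InitialThetaData.finBelow (E := E) x = u := by
  rw [hX.card_S_eq_ncard_VFbad]
  exact D.ncard_VFbad_eq_ncard_Vbad_iff_existsUnique

/-- The sufficient direction packaged for the consumer: if the place-below map is injective on `𝕍(F)^bad`, then
`|S| = |V̲^bad|`. PROVED. [cite: Mochizuki2012, IUTchI Def. 3.1 (b)/(e) p. 61–62] [claim: Mochizuki2012, status: disputed] -/
theorem card_S_eq_ncard_Vbad_of_injOn (hX : IsPilotDataOf D X)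
    (hinj : Set.InjOn (InitialThetaData.finBelow (E := E)) D.VFbad) : X.S.card = D.Vbad.ncard :=
  (hX.card_S_eq_ncard_Vbad_iff_injOn).mpr hinj

/-- In general `|V̲^bad| ≤ |S|` under the provenance link. PROVED.
[cite: Mochizuki2012, IUTchI Def. 3.1 (b)/(e) p. 61–62] [cite: DupuyHilado2025, §3.3] [claim: Mochizuki2012, status: disputed] -/
theorem ncard_Vbad_le_card_S (hX : IsPilotDataOf D X) : D.Vbad.ncard ≤ X.S.card := by
  rw [hX.card_S_eq_ncard_VFbad]
  exact D.ncard_Vbad_le_ncard_VFbad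

end Summit.ABC.IUTFork.Cor312Prov.IsPilotDataOf
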